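import Summits.BirchSwinnertonDyer.BirchSwinnertonDyer.Theorems.UniversalToricDescentTwinSplitIMCAtThreeFrameGood
import Summits.BirchSwinnertonDyer.BirchSwinnertonDyer.Theorems.UniversalToricDescentTwinSplitIMCAtThreeEveryFrame
import Summits.BirchSwinnertonDyer.BirchSwinnertonDyer.Theorems.UniversalToricDescentInvariantsTransportNormProfileFrames
import Summits.BirchSwinnertonDyer.Rank1Residual.GaloisImage.TorsionIsoImageObstruction
import Summits.BirchSwinnertonDyer.Rank1Residual.O6.X4CongruenceAnchor
import Summits.BirchSwinnertonDyer.Rank1Residual.Additive.PotSupersingularClasses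
import HarnessLib

/-!
# `TwinMuZeroAtThree` (stmt-BirchSwinnertonDyer-20400) on the GOOD-REDUCTION twins at odd `d_K` is PRINT:
# BCS 2025 Prop. 4.2.2 (Hsieh Thm. B) + cross-period frame rigidity

LEAD `bsd-wall-utd-p1` g20 (route `UniversalToricDescent`, `--supports stmt-BirchSwinnertonDyer-20400`). The item `TwinMuZeroAtThree`
asks, for the twin `E′` (non-additive at `3`) and EVERY BDP frame `L′` of `f_{E′}` at `(ι′, 𝔭)`, a coefficient of norm `1` (analytic
`μ = 0`). Its consumers (the rational-road kernel `…KernelRationalRoad.charIdeal_eq_of_sigma_of_ratwall_of_twinMu_degreeConditional`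
§1, the good-ordinary `μ`-transfer `…TwinAlgMu.twinAlgMu_of_goodOrd_of_yanZhu_of_twinMuZero`, kernel⁵) instantiate it ONLY at the
kernel's Heegner field (`d_K` odd) and at the kernel's twin buckets (good ordinary · multiplicative très ramifié · good supersingular
`a₃ = 0`). This file shows that on every GOOD twin (ordinary or supersingular, any `a₃`) at odd `d_K` the conclusion is PRINT:

* BCS 2025 Prop. 4.2.2 (`h422 : BurungaleCastellaSkinner2025.prop422_exists_isBDPLFunction_mu_eq_zero`, typed for `2 < p`, GOOD
  reduction, (Heeg), (spl), `d_K` odd, `d_K ≠ −3`, (irr_K); source Hsieh 2014 Thm. B) supplies ONE frame `L₃` with a unit coefficient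
  (`UniversalToricDescentTwinSplit.exists_frame_mu_eq_zero_of_good`);
* two frames of the same `(ι′, 𝔭, κ, γ, f)` with non-zero periods generate the SAME ideal of `R₀⟦T⟧`
  (`UniversalToricDescentTwinSplit.span_singleton_eq_of_isBDPLFunction`, cross-period rigidity, any `p`), so every frame `L′` divides
  `L₃` and inherits a norm-one coefficient (ultrametric inequality);
* `d_K ≠ −3` is automatic from the degree-one prime `𝔭 ∋ 3` (`discr_ne_neg_three_of_degreeOne`).

Results: `exists_norm_coeff_eq_one_of_good_of_bcs422` (pointwise) and `twinMuZeroAtThree_good_odd_of_bcs422` — the text of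
`TwinMuZeroAtThree` with `¬ Addv W′ 3` replaced by `W′.HasGoodReductionAtPrime 3` and `Odd (NumberField.discr K)` inserted after the
Heegner hypotheses, GRANTED `h422` only. CONSEQUENCE FOR THE ROUTE (LEAD finding, for the pen): the research residue of 20400 is the
MULTIPLICATIVE bucket (`3 ∥ N′`; B = 675 très-ramifié classes — Hsieh/BCS need `p ∤ N′`, Castella 2018 needs `p ≥ 5`), exactly as for
`TwinAlgMuZeroAtThree` (24254) after R2; a consumer-minimal restate of 20400 (odd `d_K`, kernel buckets) would let this file close its
good half by name with `BCSMuZeroInput` (stmt-…-20790, = `h422`) as the print leaf. THEOREMS ONLY; CONDITIONAL on the named fact `h422`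
(displayed hypothesis); no `sorry`; imports no `Theses` module; BSD is proved for no curve by this file.

References: [BurungaleCastellaSkinner2025] Prop. 4.2.2 (§4.2, pp. 8–9 of arXiv:2405.00270v2); [Hsieh2014] Thm. B; [Castella2018]
Thm. 3.1; folklore (units of `R₀⟦T⟧`).
-/

noncomputable section

open scoped Classical

set_option linter.dupNamespace false
set_option autoImplicit false

namespace Summit.BirchSwinnertonDyer.BirchSwinnertonDyer.Theorems.UniversalToricDescentTwinMuZeroGood

open WeierstrassCurve NumberField IsDedekindDomain Field
  Literature.NumberTheory.EllipticCurves
  Literature.NumberTheory.EllipticCurves.ModularForms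
  Literature.NumberTheory.EllipticCurves.Rank1Residual
  Summit.BirchSwinnertonDyer.Rank1Residual
  Summit.BirchSwinnertonDyer.Rank1Residual.X11b
  Summit.BirchSwinnertonDyer.Rank1Residual.X11b.Halves
  Summit.BirchSwinnertonDyer.BirchSwinnertonDyer.Theorems.SchneiderFree
  Summit.BirchSwinnertonDyer.BirchSwinnertonDyer.Theorems.UniversalToricDescentTwinSplit
  Summit.BirchSwinnertonDyer.BirchSwinnertonDyer.Theorems.UniversalToricDescentNormProfile

/-- **Analytic `μ = 0` for EVERY frame of a GOOD twin at odd `d_K` (pointwise), GRANTED BCS 2025 Prop. 4.2.2.** `W′/ℚ` elliptic with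
good reduction at `3` and `ρ̄_{W′,3}` onto; `Dt′` a modular parametrisation datum of level `N′`; `K` imaginary quadratic, Heegner for
`N′`, `d_K` odd; `κ` anticyclotomic with topological generator `γ`; `𝔭 ∋ 3` of degree one; `ι′` inducing `𝔭`. Then every frame
`(Ω_K ≠ 0, Ω_p ≠ 0, L′)` with `IsBDPLFunction ι′ 𝔭 κ γ Dt′.f Ω_K Ω_p L′` has a coefficient of norm `1`: the `μ = 0` frame `L₃` of
Prop. 4.2.2 generates the same ideal as `L′` (cross-period rigidity), so `L′ ∣ L₃` and a divisor of a series with a unit coefficient has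
one. [cite: BurungaleCastellaSkinner2025, Prop. 4.2.2 (§4.2, pp. 8–9 of arXiv:2405.00270v2)] [cite: Hsieh2014, Thm. B]
[cite: Castella2018, Thm. 3.1 (arXiv:1704.06608 p. 9)] -/
theorem exists_norm_coeff_eq_one_of_good_of_bcs422
    (h422 : BurungaleCastellaSkinner2025.prop422_exists_isBDPLFunction_mu_eq_zero)
    (W' : WeierstrassCurve ℚ) [W'.IsElliptic] (N' : ℕ) [NeZero N']
    (K : Type) [Field K] [NumberField K] (Dt' : ModularParametrizationData W' N')
    (hgood : W'.HasGoodReductionAtPrime 3) (hsurj : W'.HasSurjectiveModNGaloisRep 3)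
    (hK : IsImaginaryQuadratic K) (hH : SatisfiesHeegnerHypothesis N' K) (hodd : Odd (NumberField.discr K))
    (κ : ZpExtension K 3) (hκ : κ.IsAnticyclotomic) (γ : absoluteGaloisGroup K) [hγ : Fact (κ.IsTopGenerator γ)]
    (𝔭 : HeightOneSpectrum (𝓞 K)) (h𝔭 : ((3 : ℕ) : 𝓞 K) ∈ 𝔭.asIdeal)
    (he : 𝔭.asIdeal.ramificationIdx (𝓞 ℚ) = 1) (hf : 𝔭.asIdeal.inertiaDeg (𝓞 ℚ) = 1)
    (ι' : PadicAlgCl 3 ≃+* ℂ) (hι' : BranchInducesPrime 3 ι' 𝔭)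
    {ΩK : ℂ} {Ωp : ℂ_[3]} {L' : UnrSeries 3} (hΩK : ΩK ≠ 0) (hΩp : Ωp ≠ 0)
    (hL' : IsBDPLFunction ι' 𝔭 κ γ Dt'.f ΩK Ωp L') :
    ∃ i : ℕ, ‖((PowerSeries.coeff i L' : unrIntegers 3) : ℂ_[3])‖ = 1 := by
  have hd3 : NumberField.discr K ≠ -3 := discr_ne_neg_three_of_degreeOne hK h𝔭 he hf
  -- the `μ = 0` frame of BCS Prop. 4.2.2
  obtain ⟨ΩK₃, Ωp₃, L₃, hΩK₃, hL₃, k, hk⟩ :=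
    exists_frame_mu_eq_zero_of_good h422 W' N' K Dt' hgood hsurj hK hH hodd hd3 κ hκ γ 𝔭 h𝔭 he hf ι' hι'
  have hΩp₃ : ((Ωp₃ : unrIntegers 3) : ℂ_[3]) ≠ 0 := by
    intro h0
    have h1 := norm_coe_units_unrIntegers 3 Ωp₃
    rw [h0, norm_zero] at h1
    exact zero_ne_one h1
  have hk1 : ‖((PowerSeries.coeff k L₃ : unrIntegers 3) : ℂ_[3])‖ = 1 := (unrIntegers.isUnit_iff_norm_eq_one _).mp hk
  -- cross-period rigidity: `(L′) = (L₃)`, so `L′ ∣ L₃`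
  have hspan : Ideal.span ({L₃} : Set (UnrSeries 3)) = Ideal.span {L'} :=
    span_singleton_eq_of_isBDPLFunction hK hκ hγ.out hΩK hΩK₃ hΩp hΩp₃ hL' hL₃
  have hdvd : L' ∣ L₃ := Ideal.mem_span_singleton.mp (hspan ▸ Ideal.mem_span_singleton_self L₃)
  -- a divisor of a series with a norm-one coefficient has a norm-one coefficient
  by_contra hne
  have hlt : ∀ i, ‖((PowerSeries.coeff i L' : unrIntegers 3) : ℂ_[3])‖ < 1 :=
    fun i ↦ lt_of_le_of_ne (norm_coeff_le_one _ i) (fun h ↦ hne ⟨i, h⟩)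
  obtain ⟨q, hq⟩ := hdvd
  have h := norm_coeff_mul_lt_one_of_lt q (n := k + 1) (fun i _ ↦ hlt i) k (Nat.lt_succ_self k)
  rw [mul_comm, ← hq] at h
  exact absurd hk1 (ne_of_lt h)

/-- **`TwinMuZeroAtThree` (stmt-BirchSwinnertonDyer-20400) on GOOD twins at odd `d_K`, GRANTED BCS 2025 Prop. 4.2.2** — the item's text
with `¬ Addv W′ 3` replaced by `W′.HasGoodReductionAtPrime 3` and `Odd (NumberField.discr K) →` inserted after the two Heegner
hypotheses; every other binder VERBATIM (the wild curve `W`, the congruence and the level data are idle here, as in the item). The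
multiplicative bucket (`3 ∥ N′`) is NOT covered (research at `p = 3`). CONDITIONAL on the displayed named fact `h422`; BSD is proved for
no curve by this. [cite: BurungaleCastellaSkinner2025, Prop. 4.2.2 (§4.2, pp. 8–9 of arXiv:2405.00270v2)] [cite: Hsieh2014, Thm. B] -/
theorem twinMuZeroAtThree_good_odd_of_bcs422
    (h422 : BurungaleCastellaSkinner2025.prop422_exists_isBDPLFunction_mu_eq_zero) :
    ∀ (W : WeierstrassCurve ℚ) [W.IsElliptic] [W.IsGloballyMinimal] (W' : WeierstrassCurve ℚ) [W'.IsElliptic]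
      [W'.IsGloballyMinimal] (N N' : ℕ) [NeZero N] [NeZero N'] (K : Type) [Field K] [NumberField K]
      (Dt : ModularParametrizationData W N) (Dt' : ModularParametrizationData W' N'),
      Additive.ClassO6 W 3 → W.HasSurjectiveModNGaloisRep 3 → W.analyticRank = 1 → W.conductorNorm ℤ = N →
      O6.ModPCongruent W' W 3 → W'.HasGoodReductionAtPrime 3 → W'.conductorNorm ℤ = N' →
      IsImaginaryQuadratic K → SatisfiesHeegnerHypothesis N K → SatisfiesHeegnerHypothesis N' K →
      Odd (NumberField.discr K) →
      ∀ (κ : ZpExtension K 3), κ.IsAnticyclotomic → ∀ (γ : absoluteGaloisGroup K) [Fact (κ.IsTopGenerator γ)]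
        (𝔭 : HeightOneSpectrum (𝓞 K)), ((3 : ℕ) : 𝓞 K) ∈ 𝔭.asIdeal →
        𝔭.asIdeal.ramificationIdx (𝓞 ℚ) = 1 → 𝔭.asIdeal.inertiaDeg (𝓞 ℚ) = 1 →
      ∀ (𝔭' : HeightOneSpectrum (𝓞 K)), ((3 : ℕ) : 𝓞 K) ∈ 𝔭'.asIdeal → 𝔭' ≠ 𝔭 →
      ∀ (ι' : PadicAlgCl 3 ≃+* ℂ), BranchInducesPrime 3 ι' 𝔭 →
      ∀ (ΩK : ℂ) (Ωp : ℂ_[3]) (L' : UnrSeries 3), ΩK ≠ 0 → Ωp ≠ 0 →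
        IsBDPLFunction ι' 𝔭 κ γ Dt'.f ΩK Ωp L' →
        ∃ i : ℕ, ‖((PowerSeries.coeff i L' : unrIntegers 3) : ℂ_[3])‖ = 1 := by
  intro W _ _ W' _ _ N N' _ _ K _ _ Dt Dt' _ hsurj _ _ hc hgood _ hK _ hH' hodd κ hκ γ _ 𝔭 h𝔭 he hf 𝔭' _ _ ι' hι' ΩK Ωp L'
    hΩK hΩp hL'
  -- onto image passes along `E′[3] ≅ E[3]` (`GaloisImage.hasSurjectiveModNGaloisRep_of_torsionIso`)
  have hsurj' : W'.HasSurjectiveModNGaloisRep 3 := by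
    obtain ⟨e, he⟩ := hc
    refine GaloisImage.hasSurjectiveModNGaloisRep_of_torsionIso e.symm (fun σ Q ↦ ?_) hsurj
    apply e.injective
    rw [he, e.apply_symm_apply, e.apply_symm_apply]
  exact exists_norm_coeff_eq_one_of_good_of_bcs422 h422 W' N' K Dt' hgood hsurj' hK hH' hodd κ hκ γ 𝔭 h𝔭 he hf
    ι' hι' hΩK hΩp hL'

end Summit.BirchSwinnertonDyer.BirchSwinnertonDyer.Theorems.UniversalToricDescentTwinMuZeroGood

end
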